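import Summits.Ventures.QEC.CircuitDistance.ETowerKZ
import Summits.Ventures.QEC.CircuitDistance.ETowerBase
import HarnessLib

/-!
# E-fold tower ([[144,12,12]], W = 9, node K) — sector Z, slices 1–1 of `T3Z`

STEP 2 of R152 (2) (CARD-7, idea-1 g3/g4; generic port + STEP2-ASSEMBLY-SPEC type-1 g2). `T3Z` = the canonical (orbit-minimal) representatives of the
non-zero `V₃`-kernel base words of weight `≤ 9` of the extended `E(3,3)` table `TE3` (sector Z, record slot order), as ASCENDING numerals, cut into
consecutive slices `SZ_i` (`T3Z = SZ_0 ++ SZ_1 ++ …`, module `ETowerT3Z`). Per slice: the UNIT fact (§B8 (ii)) — the nested guarded tower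
`nodeA` (levels A→B→C→`ktop`) passes on `bitsOf 45 0 u` for every `u` — and the BASE-SLICE fact (§B9) — `sliceCheck` (below `2^45`, kernel word of
`tab TE3 15`, weight in `[1,9]`, orbit-minimal) and the per-weight orbit-size sums `osums`. All `decide +kernel`; predicted kernel seconds = idea-1's
`enest` K-node model. No `native_decide`. Emitted by qec-cdx-eng-1 g2 (`emit_step2.py`). Nothing here asserts a value of `d_circ`.
-/

set_option maxRecDepth 100000

namespace Summit.Ventures.QEC.CircuitDistance.ETower.SecZ

open Summit.Ventures.QEC.Census Summit.Ventures.QEC.Census.Fold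

/-- slice 1 of `T3Z`: 1 canonical base words (weights [3]; predicted 258.8 s on node K; s ≥ 1-rich). -/
def SZ_1 : List ℕ := [263680]

set_option maxHeartbeats 400000000 in
/-- UNIT FACT (§B8 (ii)): every word of slice 1 passes the tower `nodeA`. -/
theorem unitsZ_1 : (SZ_1.map (bitsOf 45 0)).all nodeA = true := by decide +kernel

set_option maxHeartbeats 400000000 in
/-- BASE-SLICE FACT (§B9): slice 1 passes `sliceCheck` over `tab TE3 15` and has per-weight orbit-size sums `[0, 0, 9, 0, 0, 0, 0, 0, 0]`. -/
theorem baseZ_1 : sliceCheck (tab TE3 15) 3 3 5 9 SZ_1 = true ∧ osums 3 3 5 9 SZ_1 = [0, 0, 9, 0, 0, 0, 0, 0, 0] := by decide +kernel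

end Summit.Ventures.QEC.CircuitDistance.ETower.SecZ
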